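import Summits.CriticalPhenomena.Ising3DConformalLimit.Theorems.PerfectScreeningSubharmonicOffOriginKlBandDefs
import Summits.CriticalPhenomena.Ising3DConformalLimit.Theorems.PerfectScreeningSubharmonicOffOriginStubBandSubharmonic
import Summits.CriticalPhenomena.Ising3DConformalLimit.Theorems.PerfectScreeningSubharmonicOffOriginStubIsoMassDisintegration
import Summits.CriticalPhenomena.Ising3DConformalLimit.Theorems.PerfectScreeningSubharmonicOffOriginStubLayerKernel

/-!
# Line `kl-band-positivity` — skeleton v3 for crux `SubharmonicOffOrigin` (stmt-CriticalPhenomena-1341)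

Route `PerfectScreening` (Summits/CriticalPhenomena/Ising3DConformalLimit), crux r2 "SubH":
`∀ x ≠ 0, 6·G(x) ≤ ∑ᵢ (G(x+eᵢ) + G(x−eᵢ))`, `G = criticalTwoPoint 3 = ⟨σ₀σ_x⟩⁺_{β_c(3)}`.

Lead `prover-line-stmt-CriticalPhenomena-1341-0`, 2026-08-16. The OBJECTS of the line and the six
registered stub SIGNATURES `Sig.stub_*` now live in the landed module
`Theorems/PerfectScreeningSubharmonicOffOriginKlBandDefs.lean` (p86386; namespace
`Summit.CriticalPhenomena.Ising3DConformalLimit.Theorems.PerfectScreening.KlBand`), and four of the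
six stubs are LANDED theorems of that namespace:

* `stub_bandSubharmonic`      — LANDED p88550 (`…StubBandSubharmonic.lean`, the band lemma).
* `stub_isoMassDisintegration`— LANDED p92345 (`…StubIsoMassDisintegration.lean`).
* `stub_layerKernel`          — LANDED p92900 (`…StubLayerKernel.lean`; existential layer kernels as
                                 minimal nonnegative solutions of the killed-walk layer recursion).
* `stub_jointSpectralMeasure` — PROVED, gate verify pending p94905 (`…StubJointSpectralMeasure.lean`,
                                 helpers `…JointSpecTorus.lean` p93780, `…JointSpecLimit.lean` p93855
                                 LANDED); kept as a `sorry` HERE only until the module is importable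
                                 (then: add the import, delete the local copy).
* `stub_exactLightCone`       — CRUX-level, OPEN; the line's sharp kill. Lead's analysis (NOTES.md,
                                 2026-08-16): clause (ii) EDGE SATURATION is false for the 3D model by
                                 conformal perturbation theory (non-integer Lorentz-violating correction
                                 exponents, ω_C = Δ_C − 3 = 2.0227, vs the integer |k|³ of ω₀(k));
                                 adversarial check delegated.
* `stub_fibrePositivity`      — CRUX-level, OPEN, the HARDEST (held by the lead); conditional on
                                 `stub_exactLightCone` by design.

Composition `SubharmonicOffOrigin_of` (no sorry): `Sig.stub_jointSpectralMeasure →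
Sig.stub_exactLightCone → Sig.stub_isoMassDisintegration → Sig.stub_fibrePositivity →
Sig.stub_layerKernel → Sig.stub_bandSubharmonic → PerfectScreening.SubharmonicOffOrigin` BY NAME;
`SubharmonicOffOrigin_skeleton` instantiates it with the six stubs (four of them tree theorems).

Disproof.lean (cdisprove v3, 2026-08-16 §(f)) honoured: `x ≠ 0` is consumed in
`SubharmonicOffOrigin_of` (choice of `i₀` with `x i₀ ≠ 0`; the band lemma is false on the source
plane); exact balance / axis sum rule are predictions of the representation (`m` charges every
neighbourhood of `θ = 1`); MC verdict "NO KILL, D > 0 at all 164 sites ≤ 8" and "LSC marginal: the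
odd threshold tracks ω₀(k) to ≲ 0.005 up to the zone corner" are consistent with stub 2 (i) and
neither confirm nor refute stub 2 (ii) at that resolution. `-- Targets`: none for this line yet.
-/

noncomputable section

open MeasureTheory ProbabilityTheory
open Literature.Probability.LatticeModels

namespace Summit.CriticalPhenomena.Ising3DConformalLimit.Theorems.PerfectScreening.KlBand

/-! ### The registered stubs not yet importable from the tree (sorries live ONLY here) -/

/-- **stub 1 (support, known; PROVED — p94905 pending gate verify).** JOINT SPECTRAL MEASURE in
every coordinate direction: a finite positive measure `ρ` on `(0,1] × 𝕋²` with
`⟨σ₀σ_x⟩⁺_{β_c(3)} = ∫ λ^{|x_{i₀}|} cos(k·x̌) dρ(λ,k)` for all `x ∈ ℤ³`. Local placeholder until the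
module `…Theorems.PerfectScreeningSubharmonicOffOriginStubJointSpectralMeasure` is in the tree. -/
theorem stub_jointSpectralMeasure : Sig.stub_jointSpectralMeasure := by
  sorry

/-- **stub 2 (CRUX-level, open; the line's sharp kill) — EXACT LIGHT CONE at `β_c(3)`.**
(i) LSC: no spectral weight strictly below `ω₀(k) = arccosh(1 + k̂²/2)`; (ii) EDGE SATURATION: the
edge is attained at every momentum carrying weight. d = 2: a theorem (duality + free fermions:
`cosh γ_q = 2 − cos q` at `K_c`). d = 3: the lead's conformal-perturbation analysis says (ii) FAILS on a
punctured neighbourhood of `k = 0` (edge excess `τ(k) = |k|³/24 + Σⱼkⱼ⁴/(24|k|) + O(|k|^{3.0227}) > 0`),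
while (i) holds there; MC (cdisprove §(f)): threshold tracks `ω₀` within `0.005` up to the zone corner. -/
theorem stub_exactLightCone : Sig.stub_exactLightCone := by
  sorry

/-- **stub 4 (CRUX-level, open; the HARDEST — held by the lead).** FIRST-LAYER FIBRE POSITIVITY at
`β_c(3)`, conditional on the exact light cone: in any iso-mass representation of the critical
two-point function, `m`-a.e. massive fibre has a nonnegative first-layer profile on `ℤ²`. If stub 2
(ii) is false this statement is vacuous and the line is dead at stub 2 (planner's pre-registered
criterion; with a positive edge excess the free-mass fibres are rim-concentrated and oscillate). -/
theorem stub_fibrePositivity : Sig.stub_fibrePositivity := by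
  sorry

/-! ### Composition (kernel-checked, no sorry): the six stub statements imply the crux BY NAME -/

/-- **`kl-band-positivity` closes the crux.**  For `x ≠ 0` pick a coordinate `i₀` with `x i₀ ≠ 0`,
take the joint spectral measure in direction `i₀` (stub 1), impose the exact light cone (stub 2, LSC
part), disintegrate along the free invariant mass (stub 3), and apply the band lemma (stub 6) with
first-layer fibre positivity (stub 4, claimed under stub 2) and the layer kernels (stub 5). -/
theorem SubharmonicOffOrigin_of :
    Sig.stub_jointSpectralMeasure → Sig.stub_exactLightCone → Sig.stub_isoMassDisintegration →
      Sig.stub_fibrePositivity → Sig.stub_layerKernel → Sig.stub_bandSubharmonic →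
        Summit.CriticalPhenomena.Ising3DConformalLimit.Theses.PerfectScreening.SubharmonicOffOrigin := by
  intro h1 h2 h3 h4 h5 h6 x hx
  -- some coordinate of `x ≠ 0` is nonzero: the source plane of that direction misses `x`
  obtain ⟨i₀, hi₀⟩ : ∃ i₀ : Fin 3, x i₀ ≠ 0 := by
    by_contra hall
    push Not at hall
    exact hx (funext hall)
  -- joint spectral measure in direction `i₀` (stub 1), exact light cone ⇒ LSC (stub 2),
  -- iso-mass disintegration (stub 3)
  obtain ⟨ρ, hfin, hwin, hrep⟩ := h1 i₀
  have hlsc : ρ lscViolating = 0 := (h2 i₀ ρ hfin hwin hrep).1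
  obtain ⟨m, κ, hR⟩ := h3 (criticalTwoPoint 3) i₀ ρ hfin hwin hlsc hrep
  -- band lemma (stub 6) fed with the layer kernels (stub 5) and fibre positivity (stub 4 under stub 2)
  exact h6 h5 (criticalTwoPoint 3) i₀ m κ hR (h4 h2 i₀ m κ hR) x hi₀

/-- **The skeleton instantiated**: the crux modulo the registered stubs — `stub_isoMassDisintegration`,
`stub_layerKernel`, `stub_bandSubharmonic` are the LANDED tree theorems; the remaining `sorry`s are
stubs 1 (pending import), 2 and 4. -/
theorem SubharmonicOffOrigin_skeleton :
    Summit.CriticalPhenomena.Ising3DConformalLimit.Theses.PerfectScreening.SubharmonicOffOrigin :=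
  SubharmonicOffOrigin_of stub_jointSpectralMeasure stub_exactLightCone
    stub_isoMassDisintegration stub_fibrePositivity stub_layerKernel stub_bandSubharmonic

end Summit.CriticalPhenomena.Ising3DConformalLimit.Theorems.PerfectScreening.KlBand

end
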